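import Summits.CriticalPhenomena.PercolationContinuityZ3.Theorems.PercNearOneGluingNoHeavyPcintAdaptiveDomination
import HarnessLib

/-!
# PCINT lane, king route, K1 step (3), tools: resampling identities for product weights

Cell `prim-pcint`, seat `prim-pcint-1` (gen 10); memo `run/shared/lean/prim/pcint/KING-ROUTE.md` §K1 (3).

Generic finite-sum identities for a PRODUCT weight `pw m u = ∏_v m v (u v)` on `V → S` (`V`, `S` finite; one-site
weights `m v` of total mass `1`), used by the Markov decomposition of van den Berg–Ermakov's local law (K1 step (3)):

* `sum_pw_resample` — **single-site resampling**: `Σ_u pw u · F u = Σ_u pw u · Σ_s m v s · F (u[v ↦ s])`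
  (replace the coordinate at `v` by an independent copy; proved by the involution `(u, s) ↦ (u[v ↦ s], u v)`);
* `sum_pw_mul_blind`, `sum_pw_mul_prod_blind` — a factor reading only the site `v` (resp. the sites of `T`) integrates
  out against anything blind to `v` (resp. `T`);
* `readB` / `lawB` / `sum_pw_mul_read_pull`, `sum_pw_read3`, `sum_pw_read4` — the joint law of Boolean READS of three
  (four) distinct optional sites is the product of the one-site pushforwards (an absent site reads `false`);
* small facts on product laws on `Bool × Bool × Bool` / `Bool⁴`: swapping the weight of a coordinate the integrand ignores
  (`sum_law3_congr_fst/snd/thd`), and the coordinatewise comparison `sum_law4_mono` (larger success probabilities give a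
  larger expectation of a monotone function) used for the origin step.
-/

namespace Summit.CriticalPhenomena.PercolationContinuityZ3.Theorems.Pcint

namespace AdaptDom

open Finset

variable {V : Type*} [Fintype V] [DecidableEq V] {S : Type*} [Fintype S] [DecidableEq S]

/-! ### Product weights with site-dependent one-site laws -/

/-- The product weight `∏_v m v (u v)` of an assignment `u : V → S`. -/
def pw (m : V → S → ℝ) (u : V → S) : ℝ := ∏ v, m v (u v)

omit [DecidableEq V] [Fintype S] [DecidableEq S] in
/-- Product weights are nonnegative when the one-site weights are. -/
theorem pw_nonneg {m : V → S → ℝ} (hm : ∀ v s, 0 ≤ m v s) (u : V → S) : 0 ≤ pw m u :=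
  Finset.prod_nonneg fun v _ => hm v (u v)

omit [DecidableEq S] in
/-- The product weight is a probability when every one-site weight is. -/
theorem sum_pw {m : V → S → ℝ} (hm1 : ∀ v, ∑ s, m v s = 1) : ∑ u : V → S, pw m u = 1 := by
  unfold pw
  rw [← Fintype.piFinset_univ, ← Finset.prod_univ_sum (fun _ => (univ : Finset S)) fun v s => m v s]
  simp only [hm1, Finset.prod_const_one]

omit [Fintype S] [DecidableEq S] in
/-- Updating one coordinate changes one factor of the product weight. -/
theorem pw_update_mul (m : V → S → ℝ) (u : V → S) (v : V) (s : S) :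
    pw m (Function.update u v s) * m v (u v) = pw m u * m v s := by
  unfold pw
  rw [Fintype.prod_eq_mul_prod_compl v (fun w => m w (Function.update u v s w)),
    Fintype.prod_eq_mul_prod_compl v (fun w => m w (u w))]
  have h : ∏ w ∈ ({v} : Finset V)ᶜ, m w (Function.update u v s w) = ∏ w ∈ ({v} : Finset V)ᶜ, m w (u w) :=
    Finset.prod_congr rfl fun w hw => by
      have hne : w ≠ v := fun h => (Finset.mem_compl.1 hw) (Finset.mem_singleton.2 h)
      rw [Function.update_of_ne hne]
  rw [h, Function.update_self]
  ring

omit [DecidableEq S] in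
/-- **Single-site resampling**: replacing the coordinate at `v` by an independent copy does not change the
expectation: `Σ_u pw u · F u = Σ_u pw u · Σ_s m v s · F (u[v ↦ s])`. -/
theorem sum_pw_resample (m : V → S → ℝ) (hm1 : ∀ v, ∑ s, m v s = 1) (v : V) (F : (V → S) → ℝ) :
    ∑ u, pw m u * F u = ∑ u, pw m u * ∑ s, m v s * F (Function.update u v s) := by
  have hL : ∑ u, pw m u * F u = ∑ z : (V → S) × S, pw m z.1 * m v z.2 * F z.1 := by
    rw [Fintype.sum_prod_type]
    refine Finset.sum_congr rfl fun u _ => ?_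
    have : ∑ s, pw m u * m v s * F u = pw m u * F u * ∑ s, m v s := by
      rw [Finset.mul_sum]; exact Finset.sum_congr rfl fun s _ => by ring
    rw [this, hm1, mul_one]
  have hR : ∑ u, pw m u * ∑ s, m v s * F (Function.update u v s) =
      ∑ z : (V → S) × S, pw m z.1 * m v z.2 * F (Function.update z.1 v z.2) := by
    rw [Fintype.sum_prod_type]
    refine Finset.sum_congr rfl fun u _ => ?_
    rw [Finset.mul_sum]
    exact Finset.sum_congr rfl fun s _ => by ring
  rw [hL, hR]
  -- reindex by the involution `θ (u, s) = (u[v ↦ s], u v)`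
  let θ : (V → S) × S → (V → S) × S := fun z => (Function.update z.1 v z.2, z.1 v)
  have hθ : Function.Involutive θ := by
    rintro ⟨u, s⟩
    simp only [θ, Function.update_self, Function.update_idem, Function.update_eq_self]
  refine Fintype.sum_equiv hθ.toPerm _ _ fun z => ?_
  obtain ⟨u, s⟩ := z
  change pw m u * m v s * F u =
    pw m (Function.update u v s) * m v (u v) * F (Function.update (Function.update u v s) v (u v))
  rw [Function.update_idem, Function.update_eq_self, pw_update_mul]

omit [DecidableEq S] in
/-- A factor reading only the site `v` integrates out against a function blind to `v`. -/
theorem sum_pw_mul_blind (m : V → S → ℝ) (hm1 : ∀ v, ∑ s, m v s = 1) (v : V) (f : S → ℝ) (K : (V → S) → ℝ)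
    (hK : ∀ u s, K (Function.update u v s) = K u) :
    ∑ u, pw m u * (f (u v) * K u) = (∑ s, m v s * f s) * ∑ u, pw m u * K u := by
  rw [sum_pw_resample m hm1 v]
  simp only [Function.update_self, hK]
  rw [Finset.mul_sum]
  refine Finset.sum_congr rfl fun u _ => ?_
  rw [Finset.mul_sum, Finset.sum_mul]
  exact Finset.sum_congr rfl fun s _ => by ring

omit [DecidableEq S] in
/-- Factors reading only the sites of `T` integrate out against a function blind to `T`. -/
theorem sum_pw_mul_prod_blind (m : V → S → ℝ) (hm1 : ∀ v, ∑ s, m v s = 1) (T : Finset V) (f : V → S → ℝ)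
    (K : (V → S) → ℝ) (hK : ∀ u, ∀ v ∈ T, ∀ s, K (Function.update u v s) = K u) :
    ∑ u, pw m u * ((∏ v ∈ T, f v (u v)) * K u) = (∏ v ∈ T, ∑ s, m v s * f v s) * ∑ u, pw m u * K u := by
  induction T using Finset.induction_on generalizing K with
  | empty => simp
  | insert a T haT ih =>
    simp_rw [Finset.prod_insert haT, mul_assoc]
    rw [sum_pw_mul_blind m hm1 a (f a) (fun u => (∏ v ∈ T, f v (u v)) * K u) ?_]
    · rw [ih K (fun u v hv s => hK u v (Finset.mem_insert_of_mem hv) s)]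
    · intro u s
      change (∏ v ∈ T, f v (Function.update u a s v)) * K (Function.update u a s) = (∏ v ∈ T, f v (u v)) * K u
      rw [hK u a (Finset.mem_insert_self a T) s]
      congr 1
      exact Finset.prod_congr rfl fun v hv => by rw [Function.update_of_ne (ne_of_mem_of_not_mem hv haT)]

/-! ### Boolean reads of optional sites -/

/-- Reading a Boolean off an optional site through `φ` (an absent site reads `false`). -/
def readB (φ : V → S → Bool) : Option V → (V → S) → Bool
  | none, _ => false
  | some v, u => φ v (u v)

/-- The law of a read: the pushforward of the one-site weight (point mass at `false` for an absent site). -/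
def lawB (m : V → S → ℝ) (φ : V → S → Bool) : Option V → Bool → ℝ
  | none, b => if b then 0 else 1
  | some v, b => ∑ s ∈ univ.filter (fun s => φ v s = b), m v s

omit [Fintype V] [Fintype S] [DecidableEq S] in
/-- A read does not see updates at other sites. -/
theorem readB_update_of_ne (φ : V → S → Bool) {o : Option V} {v : V} (h : o ≠ some v) (u : V → S) (s : S) :
    readB φ o (Function.update u v s) = readB φ o u := by
  cases o with
  | none => rfl
  | some w =>
    have hw : w ≠ v := fun hwv => h (by rw [hwv])
    simp only [readB, Function.update_of_ne hw]

omit [Fintype V] [DecidableEq V] [DecidableEq S] in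
/-- The law of a read has total mass `1`. -/
theorem sum_lawB (m : V → S → ℝ) (hm1 : ∀ v, ∑ s, m v s = 1) (φ : V → S → Bool) (o : Option V) :
    ∑ b, lawB m φ o b = 1 := by
  cases o with
  | none => simp [lawB]
  | some v =>
    rw [Fintype.sum_bool]
    simp only [lawB]
    have := Finset.sum_filter_add_sum_filter_not univ (fun s => φ v s = true) (fun s => m v s)
    rw [hm1 v] at this
    rw [← this]
    congr 1
    exact Finset.sum_congr (by ext s; simp) fun _ _ => rfl

omit [Fintype V] [DecidableEq V] [DecidableEq S] in
/-- The law of a read is nonnegative. -/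
theorem lawB_nonneg {m : V → S → ℝ} (hm : ∀ v s, 0 ≤ m v s) (φ : V → S → Bool) (o : Option V) (b : Bool) :
    0 ≤ lawB m φ o b := by
  cases o with
  | none => simp only [lawB]; split_ifs <;> norm_num
  | some v => exact Finset.sum_nonneg fun s _ => hm v s

omit [DecidableEq S] in
/-- **Pulling out one read**: against a function blind to the site read, the read is distributed by `lawB`:
`Σ_u pw u · K u (read o u) = Σ_b lawB o b · Σ_u pw u · K u b`. -/
theorem sum_pw_mul_read_pull (m : V → S → ℝ) (hm1 : ∀ v, ∑ s, m v s = 1) (φ : V → S → Bool) (o : Option V)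
    (K : (V → S) → Bool → ℝ) (hK : ∀ u v s b, o = some v → K (Function.update u v s) b = K u b) :
    ∑ u, pw m u * K u (readB φ o u) = ∑ b, lawB m φ o b * ∑ u, pw m u * K u b := by
  cases o with
  | none => simp [readB, lawB]
  | some v =>
    rw [sum_pw_resample m hm1 v (fun u => K u (readB φ (some v) u))]
    simp only [readB, Function.update_self]
    have step : ∀ u : V → S, ∑ s, m v s * K (Function.update u v s) (φ v s) = ∑ b, lawB m φ (some v) b * K u b := by
      intro u
      simp_rw [hK u v _ _ rfl]
      rw [Fintype.sum_bool]
      simp only [lawB, Finset.sum_mul]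
      rw [← Finset.sum_filter_add_sum_filter_not univ (fun s => φ v s = true)]
      congr 1
      · exact Finset.sum_congr rfl fun s hs => by rw [(Finset.mem_filter.1 hs).2]
      · refine Finset.sum_congr (by ext s; simp) fun s hs => ?_
        have : φ v s = false := by simpa using (Finset.mem_filter.1 hs).2
        rw [this]
    simp_rw [step, Finset.mul_sum]
    rw [Finset.sum_comm]
    refine Finset.sum_congr rfl fun b _ => ?_
    exact Finset.sum_congr rfl fun u _ => by ring

omit [DecidableEq S] in
/-- **Joint law of three reads of distinct optional sites** = product of the one-site laws. -/
theorem sum_pw_read3 (m : V → S → ℝ) (hm1 : ∀ v, ∑ s, m v s = 1) (φ : V → S → Bool) (o₀ o₁ o₂ : Option V)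
    (h01 : ∀ v, o₀ = some v → o₁ ≠ some v) (h02 : ∀ v, o₀ = some v → o₂ ≠ some v)
    (h12 : ∀ v, o₁ = some v → o₂ ≠ some v) (G : Bool → Bool → Bool → ℝ) :
    ∑ u, pw m u * G (readB φ o₀ u) (readB φ o₁ u) (readB φ o₂ u) =
      ∑ b₀, ∑ b₁, ∑ b₂, lawB m φ o₀ b₀ * lawB m φ o₁ b₁ * lawB m φ o₂ b₂ * G b₀ b₁ b₂ := by
  have hK0 : ∀ u v s b, o₀ = some v →
      (fun u b => G b (readB φ o₁ u) (readB φ o₂ u)) (Function.update u v s) b =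
        (fun u b => G b (readB φ o₁ u) (readB φ o₂ u)) u b := by
    intro u v s b hv
    simp only [readB_update_of_ne φ (h01 v hv), readB_update_of_ne φ (h02 v hv)]
  rw [sum_pw_mul_read_pull m hm1 φ o₀ (fun u b => G b (readB φ o₁ u) (readB φ o₂ u)) hK0]
  refine Finset.sum_congr rfl fun b₀ _ => ?_
  have hK1 : ∀ u v s b, o₁ = some v →
      (fun u b => G b₀ b (readB φ o₂ u)) (Function.update u v s) b = (fun u b => G b₀ b (readB φ o₂ u)) u b := by
    intro u v s b hv
    simp only [readB_update_of_ne φ (h12 v hv)]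
  rw [sum_pw_mul_read_pull m hm1 φ o₁ (fun u b => G b₀ b (readB φ o₂ u)) hK1]
  rw [Finset.mul_sum]
  refine Finset.sum_congr rfl fun b₁ _ => ?_
  rw [sum_pw_mul_read_pull m hm1 φ o₂ (fun _ b => G b₀ b₁ b) (fun _ _ _ _ _ => rfl)]
  rw [Finset.mul_sum, Finset.mul_sum]
  refine Finset.sum_congr rfl fun b₂ _ => ?_
  rw [← Finset.sum_mul, sum_pw hm1, one_mul]
  ring

omit [DecidableEq S] in
/-- **Joint law of four reads of distinct optional sites** = product of the one-site laws. -/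
theorem sum_pw_read4 (m : V → S → ℝ) (hm1 : ∀ v, ∑ s, m v s = 1) (φ : V → S → Bool) (o₀ o₁ o₂ o₃ : Option V)
    (h01 : ∀ v, o₀ = some v → o₁ ≠ some v) (h02 : ∀ v, o₀ = some v → o₂ ≠ some v)
    (h03 : ∀ v, o₀ = some v → o₃ ≠ some v) (h12 : ∀ v, o₁ = some v → o₂ ≠ some v)
    (h13 : ∀ v, o₁ = some v → o₃ ≠ some v) (h23 : ∀ v, o₂ = some v → o₃ ≠ some v)
    (G : Bool → Bool → Bool → Bool → ℝ) :
    ∑ u, pw m u * G (readB φ o₀ u) (readB φ o₁ u) (readB φ o₂ u) (readB φ o₃ u) =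
      ∑ b₀, ∑ b₁, ∑ b₂, ∑ b₃,
        lawB m φ o₀ b₀ * lawB m φ o₁ b₁ * lawB m φ o₂ b₂ * lawB m φ o₃ b₃ * G b₀ b₁ b₂ b₃ := by
  have hK0 : ∀ u v s b, o₀ = some v →
      (fun u b => G b (readB φ o₁ u) (readB φ o₂ u) (readB φ o₃ u)) (Function.update u v s) b =
        (fun u b => G b (readB φ o₁ u) (readB φ o₂ u) (readB φ o₃ u)) u b := by
    intro u v s b hv
    simp only [readB_update_of_ne φ (h01 v hv), readB_update_of_ne φ (h02 v hv), readB_update_of_ne φ (h03 v hv)]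
  rw [sum_pw_mul_read_pull m hm1 φ o₀ (fun u b => G b (readB φ o₁ u) (readB φ o₂ u) (readB φ o₃ u)) hK0]
  refine Finset.sum_congr rfl fun b₀ _ => ?_
  rw [sum_pw_read3 m hm1 φ o₁ o₂ o₃ h12 h13 h23 (fun b₁ b₂ b₃ => G b₀ b₁ b₂ b₃), Finset.mul_sum]
  refine Finset.sum_congr rfl fun b₁ _ => ?_
  rw [Finset.mul_sum]
  refine Finset.sum_congr rfl fun b₂ _ => ?_
  rw [Finset.mul_sum]
  exact Finset.sum_congr rfl fun b₃ _ => by ring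

/-! ### Product laws on three and four Boolean coordinates -/

/-- Swapping the law of the FIRST coordinate when the integrand ignores it. -/
theorem sum_law3_congr_fst (r r' r₁ r₂ : Bool → ℝ) (hr : ∑ b, r b = 1) (hr' : ∑ b, r' b = 1)
    (G : Bool → Bool → Bool → ℝ) (hG : ∀ b₁ b₂, G true b₁ b₂ = G false b₁ b₂) :
    ∑ b₀, ∑ b₁, ∑ b₂, r b₀ * r₁ b₁ * r₂ b₂ * G b₀ b₁ b₂ = ∑ b₀, ∑ b₁, ∑ b₂, r' b₀ * r₁ b₁ * r₂ b₂ * G b₀ b₁ b₂ := by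
  simp only [Fintype.sum_bool] at hr hr'
  simp only [Fintype.sum_bool, hG]
  have h1 : r true = 1 - r false := by linarith
  have h2 : r' true = 1 - r' false := by linarith
  rw [h1, h2]; ring

/-- Swapping the law of the SECOND coordinate when the integrand ignores it. -/
theorem sum_law3_congr_snd (r₀ r r' r₂ : Bool → ℝ) (hr : ∑ b, r b = 1) (hr' : ∑ b, r' b = 1)
    (G : Bool → Bool → Bool → ℝ) (hG : ∀ b₀ b₂, G b₀ true b₂ = G b₀ false b₂) :
    ∑ b₀, ∑ b₁, ∑ b₂, r₀ b₀ * r b₁ * r₂ b₂ * G b₀ b₁ b₂ = ∑ b₀, ∑ b₁, ∑ b₂, r₀ b₀ * r' b₁ * r₂ b₂ * G b₀ b₁ b₂ := by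
  simp only [Fintype.sum_bool] at hr hr'
  simp only [Fintype.sum_bool, hG]
  have h1 : r true = 1 - r false := by linarith
  have h2 : r' true = 1 - r' false := by linarith
  rw [h1, h2]; ring

/-- Swapping the law of the THIRD coordinate when the integrand ignores it. -/
theorem sum_law3_congr_thd (r₀ r₁ r r' : Bool → ℝ) (hr : ∑ b, r b = 1) (hr' : ∑ b, r' b = 1)
    (G : Bool → Bool → Bool → ℝ) (hG : ∀ b₀ b₁, G b₀ b₁ true = G b₀ b₁ false) :
    ∑ b₀, ∑ b₁, ∑ b₂, r₀ b₀ * r₁ b₁ * r b₂ * G b₀ b₁ b₂ = ∑ b₀, ∑ b₁, ∑ b₂, r₀ b₀ * r₁ b₁ * r' b₂ * G b₀ b₁ b₂ := by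
  simp only [Fintype.sum_bool] at hr hr'
  simp only [Fintype.sum_bool, hG]
  have h1 : r true = 1 - r false := by linarith
  have h2 : r' true = 1 - r' false := by linarith
  rw [h1, h2]; ring

/-- **One-coordinate comparison**: for `h true ≥ h false` and success probabilities `r true ≥ r' true` (both laws of
mass `1`), `Σ_b r' b · h b ≤ Σ_b r b · h b`. -/
theorem sum_bool_mono_law (r r' : Bool → ℝ) (hr : ∑ b, r b = 1) (hr' : ∑ b, r' b = 1) (hle : r' true ≤ r true)
    (h : Bool → ℝ) (hh : h false ≤ h true) : ∑ b, r' b * h b ≤ ∑ b, r b * h b := by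
  simp only [Fintype.sum_bool] at hr hr' ⊢
  have h1 : r false = 1 - r true := by linarith
  have h2 : r' false = 1 - r' true := by linarith
  rw [h1, h2]
  nlinarith

/-- **Coordinatewise comparison of product laws on `Bool⁴`**: if each coordinate's success probability under `r` is at
least that under `r'` (all of mass `1`, `r` nonnegative), then for every monotone `G`,
`Σ r'⊗4 · G ≤ Σ r⊗4 · G`. -/
theorem sum_law4_mono (r r' : Fin 4 → Bool → ℝ) (hr : ∀ j, ∑ b, r j b = 1) (hr' : ∀ j, ∑ b, r' j b = 1)
    (hr0 : ∀ j b, 0 ≤ r j b) (hr'0 : ∀ j b, 0 ≤ r' j b) (hle : ∀ j, r' j true ≤ r j true)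
    (G : Bool → Bool → Bool → Bool → ℝ)
    (hG : ∀ b₀ b₁ b₂ b₃ b₀' b₁' b₂' b₃', b₀ ≤ b₀' → b₁ ≤ b₁' → b₂ ≤ b₂' → b₃ ≤ b₃' →
      G b₀ b₁ b₂ b₃ ≤ G b₀' b₁' b₂' b₃') :
    ∑ b₀, ∑ b₁, ∑ b₂, ∑ b₃, r' 0 b₀ * r' 1 b₁ * r' 2 b₂ * r' 3 b₃ * G b₀ b₁ b₂ b₃ ≤
      ∑ b₀, ∑ b₁, ∑ b₂, ∑ b₃, r 0 b₀ * r 1 b₁ * r 2 b₂ * r 3 b₃ * G b₀ b₁ b₂ b₃ := by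
  -- coordinate 3
  have s3 : ∀ b₀ b₁ b₂, ∑ b₃, r' 3 b₃ * G b₀ b₁ b₂ b₃ ≤ ∑ b₃, r 3 b₃ * G b₀ b₁ b₂ b₃ := fun b₀ b₁ b₂ =>
    sum_bool_mono_law (r 3) (r' 3) (hr 3) (hr' 3) (hle 3) _
      (hG _ _ _ _ _ _ _ _ le_rfl le_rfl le_rfl (by decide))
  -- coordinate 2, with the monotone partial sum
  have m2 : ∀ b₀ b₁, (∑ b₃, r 3 b₃ * G b₀ b₁ false b₃) ≤ ∑ b₃, r 3 b₃ * G b₀ b₁ true b₃ := fun b₀ b₁ =>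
    Finset.sum_le_sum fun b₃ _ => mul_le_mul_of_nonneg_left (hG _ _ _ _ _ _ _ _ le_rfl le_rfl (by decide) le_rfl) (hr0 3 b₃)
  have s2 : ∀ b₀ b₁, ∑ b₂, r' 2 b₂ * ∑ b₃, r' 3 b₃ * G b₀ b₁ b₂ b₃ ≤ ∑ b₂, r 2 b₂ * ∑ b₃, r 3 b₃ * G b₀ b₁ b₂ b₃ := by
    intro b₀ b₁
    calc ∑ b₂, r' 2 b₂ * ∑ b₃, r' 3 b₃ * G b₀ b₁ b₂ b₃ ≤ ∑ b₂, r' 2 b₂ * ∑ b₃, r 3 b₃ * G b₀ b₁ b₂ b₃ :=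
          Finset.sum_le_sum fun b₂ _ => mul_le_mul_of_nonneg_left (s3 b₀ b₁ b₂) (hr'0 2 b₂)
      _ ≤ ∑ b₂, r 2 b₂ * ∑ b₃, r 3 b₃ * G b₀ b₁ b₂ b₃ :=
          sum_bool_mono_law (r 2) (r' 2) (hr 2) (hr' 2) (hle 2) (fun b₂ => ∑ b₃, r 3 b₃ * G b₀ b₁ b₂ b₃) (m2 b₀ b₁)
  have m1 : ∀ b₀, (∑ b₂, r 2 b₂ * ∑ b₃, r 3 b₃ * G b₀ false b₂ b₃) ≤ ∑ b₂, r 2 b₂ * ∑ b₃, r 3 b₃ * G b₀ true b₂ b₃ :=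
    fun b₀ => Finset.sum_le_sum fun b₂ _ => mul_le_mul_of_nonneg_left
      (Finset.sum_le_sum fun b₃ _ => mul_le_mul_of_nonneg_left
        (hG _ _ _ _ _ _ _ _ le_rfl (by decide) le_rfl le_rfl) (hr0 3 b₃)) (hr0 2 b₂)
  have s1 : ∀ b₀, ∑ b₁, r' 1 b₁ * ∑ b₂, r' 2 b₂ * ∑ b₃, r' 3 b₃ * G b₀ b₁ b₂ b₃ ≤
      ∑ b₁, r 1 b₁ * ∑ b₂, r 2 b₂ * ∑ b₃, r 3 b₃ * G b₀ b₁ b₂ b₃ := by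
    intro b₀
    calc ∑ b₁, r' 1 b₁ * ∑ b₂, r' 2 b₂ * ∑ b₃, r' 3 b₃ * G b₀ b₁ b₂ b₃
        ≤ ∑ b₁, r' 1 b₁ * ∑ b₂, r 2 b₂ * ∑ b₃, r 3 b₃ * G b₀ b₁ b₂ b₃ :=
          Finset.sum_le_sum fun b₁ _ => mul_le_mul_of_nonneg_left (s2 b₀ b₁) (hr'0 1 b₁)
      _ ≤ ∑ b₁, r 1 b₁ * ∑ b₂, r 2 b₂ * ∑ b₃, r 3 b₃ * G b₀ b₁ b₂ b₃ :=
          sum_bool_mono_law (r 1) (r' 1) (hr 1) (hr' 1) (hle 1) _ (m1 b₀)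
  have m0 : (∑ b₁, r 1 b₁ * ∑ b₂, r 2 b₂ * ∑ b₃, r 3 b₃ * G false b₁ b₂ b₃) ≤
      ∑ b₁, r 1 b₁ * ∑ b₂, r 2 b₂ * ∑ b₃, r 3 b₃ * G true b₁ b₂ b₃ :=
    Finset.sum_le_sum fun b₁ _ => mul_le_mul_of_nonneg_left
      (Finset.sum_le_sum fun b₂ _ => mul_le_mul_of_nonneg_left
        (Finset.sum_le_sum fun b₃ _ => mul_le_mul_of_nonneg_left
          (hG _ _ _ _ _ _ _ _ (by decide) le_rfl le_rfl le_rfl) (hr0 3 b₃)) (hr0 2 b₂)) (hr0 1 b₁)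
  have s0 : ∑ b₀, r' 0 b₀ * ∑ b₁, r' 1 b₁ * ∑ b₂, r' 2 b₂ * ∑ b₃, r' 3 b₃ * G b₀ b₁ b₂ b₃ ≤
      ∑ b₀, r 0 b₀ * ∑ b₁, r 1 b₁ * ∑ b₂, r 2 b₂ * ∑ b₃, r 3 b₃ * G b₀ b₁ b₂ b₃ :=
    calc ∑ b₀, r' 0 b₀ * ∑ b₁, r' 1 b₁ * ∑ b₂, r' 2 b₂ * ∑ b₃, r' 3 b₃ * G b₀ b₁ b₂ b₃
        ≤ ∑ b₀, r' 0 b₀ * ∑ b₁, r 1 b₁ * ∑ b₂, r 2 b₂ * ∑ b₃, r 3 b₃ * G b₀ b₁ b₂ b₃ :=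
          Finset.sum_le_sum fun b₀ _ => mul_le_mul_of_nonneg_left (s1 b₀) (hr'0 0 b₀)
      _ ≤ ∑ b₀, r 0 b₀ * ∑ b₁, r 1 b₁ * ∑ b₂, r 2 b₂ * ∑ b₃, r 3 b₃ * G b₀ b₁ b₂ b₃ :=
          sum_bool_mono_law (r 0) (r' 0) (hr 0) (hr' 0) (hle 0) _ m0
  -- unfold the nested form
  have key : ∀ ρ : Fin 4 → Bool → ℝ,
      ∑ b₀, ∑ b₁, ∑ b₂, ∑ b₃, ρ 0 b₀ * ρ 1 b₁ * ρ 2 b₂ * ρ 3 b₃ * G b₀ b₁ b₂ b₃ =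
        ∑ b₀, ρ 0 b₀ * ∑ b₁, ρ 1 b₁ * ∑ b₂, ρ 2 b₂ * ∑ b₃, ρ 3 b₃ * G b₀ b₁ b₂ b₃ := by
    intro ρ
    refine Finset.sum_congr rfl fun b₀ _ => ?_
    rw [Finset.mul_sum]
    refine Finset.sum_congr rfl fun b₁ _ => ?_
    rw [Finset.mul_sum, Finset.mul_sum]
    refine Finset.sum_congr rfl fun b₂ _ => ?_
    rw [Finset.mul_sum, Finset.mul_sum, Finset.mul_sum]
    exact Finset.sum_congr rfl fun b₃ _ => by ring
  rw [key r, key r']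
  exact s0

end AdaptDom

end Summit.CriticalPhenomena.PercolationContinuityZ3.Theorems.Pcint
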